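import Literature.Topology.FourManifolds.AchiralLefschetzNullTowerTrace
import HarnessLib

/-!
# The null tower, fact 4, at every universe

Topic `Literature/Topology/FourManifolds`; sequel of `AchiralLefschetzNullTowerTrace.lean`, which
discharges `Literature.Topology.FourManifolds.exists_isHandlebodyOfIndexLE_two_of_isCircleSurgery`
at universe `0` through the universe-`0` wrappers `CircleNbhd.trace`, `CircleNbhd.isOpenGluingWith_top`
of `CircleNbhdTrace.lean`.  Here the same argument is run at universe `u` directly on the
universe-polymorphic trace `SurgeryTrace.traceCobordism` of the one-sphere framed family of the tube
(`SurgeryTraceCobordism.lean`, `SurgeryTraceTop.lean`, `TraceMorseFunction.lean`), the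
re-indexing of the top-end gluing (`topA ∘ ψ`, `topB ∘ StdChart.ballDiffeo`) being proved inline
(verbatim the proofs of `CircleNbhdTrace.lean`).  Everything here is proved (theorems only).

## References

* J. Milnor, *Lectures on the h-cobordism theorem*, Princeton (1965), Lemma 3.7, Cor. 3.8,
  Thms. 3.12–3.13 (PDF pp. 15–21). [MilnorHCobordism1965]
-/

open scoped Manifold ContDiff Topology
open Set Function Filter

noncomputable section

namespace Literature.Topology.FourManifolds

universe u

open StdCircleSurgery SurgeryTrace MilnorTrace

/-- **The top end of the trace of the tube `ν` is the circle surgery along `ν`, at universe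
`u`** (re-indexing of `SurgeryTrace.isOpenGluingWith_topEnd` along the identification of the
complements and `StdChart.ballDiffeo`; verbatim `CircleNbhd.isOpenGluingWith_top`).
[cite: MilnorHCobordism1965, Def. 3.11, Thm. 3.12 (PDF pp. 17–19)] -/
theorem CircleNbhd.isOpenGluing_topEnd_univ {X : Type u} [TopologicalSpace X]
    [ChartedSpace (EuclideanSpace ℝ (Fin 4)) X] [T2Space X] [IsManifold (𝓡 4) ∞ X]
    {c : (Metric.sphere (0 : EuclideanSpace ℝ (Fin 2)) 1) → X} (ν : CircleNbhd (𝓡 4) c)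
    (fam : FramedSphereFamily (𝓡 4) X Unit 1 3) (hfam : ∀ i, fam.toFun i = ν.toFun) :
    IsOpenGluing (𝓡 4) (𝓘(ℝ, EuclideanSpace ℝ (Fin 2)).prod (𝓡 2)) (𝓡 4) (A := ↥ν.complement)
      (B := ↥discTimesSphere) (P := ↥(topEnd fam StdChart.hkl)) (circleSurgeryRel ν) := by
  -- the complements agree
  have hcores : fam.cores = range c := by
    ext x
    rw [FramedSphereFamily.mem_cores_iff]
    constructor
    · rintro ⟨i, v, rfl⟩
      refine ⟨v, ?_⟩
      show c v = fam.sphere i v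
      simp [FramedSphereFamily.sphere, hfam i, ν.apply_zero v]
    · rintro ⟨v, rfl⟩
      refine ⟨(), v, ?_⟩
      simp [FramedSphereFamily.sphere, hfam (), ν.apply_zero v]
  have hcompl : ∀ x, x ∈ fam.complement ↔ x ∈ ν.complement := fun x => by
    rw [FramedSphereFamily.mem_complement_iff, CircleNbhd.mem_complement_iff, hcores]
  obtain ⟨cd, hcd⟩ := exists_diffeomorph_opens (Diffeomorph.refl (𝓡 4) X ∞) ν.complement fam.complement
    (fun x => by rw [Diffeomorph.coe_refl, id, hcompl])
  obtain ⟨hA, hAo, hB, hBo, hU, hR⟩ := isOpenGluingWith_topEnd fam StdChart.hkl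
  -- the second gluing map re-indexed by `ballDiffeo` is a smooth embedding
  set Φ : OpenPartialHomeomorph ↥discTimesSphere ↥(topEnd fam StdChart.hkl) :=
    StdChart.ballDiffeo.toHomeomorph.toOpenPartialHomeomorph.trans (topBHomeo fam StdChart.hkl) with hΦ
  have hΦapp : ∀ b, Φ b = topB fam StdChart.hkl (StdChart.ballDiffeo b) := fun b => rfl
  have hB' : Manifold.IsSmoothEmbedding (𝓘(ℝ, EuclideanSpace ℝ (Fin 2)).prod (𝓡 2)) (𝓡 4) ∞
      (topB fam StdChart.hkl ∘ StdChart.ballDiffeo) := by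
    have hsrc : Φ.source = univ := by simp [hΦ, topBHomeo]
    have h1 : ContMDiffOn (𝓘(ℝ, EuclideanSpace ℝ (Fin 2)).prod (𝓡 2)) (𝓡 4) ∞ Φ Φ.source := by
      intro b _
      exact ((contMDiff_topB fam StdChart.hkl).comp StdChart.ballDiffeo.contMDiff b).contMDiffWithinAt
    have h2 : ContMDiffOn (𝓡 4) (𝓘(ℝ, EuclideanSpace ℝ (Fin 2)).prod (𝓡 2)) ∞ Φ.symm Φ.target := by
      rintro y hy
      have hy' : y ∈ (topBHomeo fam StdChart.hkl).target := by simpa [hΦ] using hy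
      obtain ⟨b, hb⟩ := hy'
      have h3 : ContMDiffAt (𝓡 4) (SphereSurgery.handleModelWithCorners 1 2) ∞ (topBInv fam StdChart.hkl) y :=
        contMDiffAt_topBInv fam StdChart.hkl hb
      exact (StdChart.ballDiffeo.symm.contMDiff.contMDiffAt.comp y h3).contMDiffWithinAt
    exact isSmoothEmbedding_of_openPartialHomeomorph (I := 𝓘(ℝ, EuclideanSpace ℝ (Fin 2)).prod (𝓡 2))
      (J := 𝓡 4) (n := ∞) Φ hsrc h1 h2 (ContinuousLinearEquiv.ofFinrankEq (by simp))
  have hrA : range (topA fam StdChart.hkl ∘ cd) = range (topA fam StdChart.hkl) := cd.surjective.range_comp _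
  have hrB : range (topB fam StdChart.hkl ∘ StdChart.ballDiffeo) = range (topB fam StdChart.hkl) :=
    StdChart.ballDiffeo.surjective.range_comp _
  refine ⟨topA fam StdChart.hkl ∘ cd, topB fam StdChart.hkl ∘ StdChart.ballDiffeo, hA.comp_diffeomorph cd,
    hrA ▸ hAo, hB', hrB ▸ hBo, by rw [hrA, hrB, hU], fun a b => ?_⟩
  rw [comp_apply, comp_apply, hR]
  simp only [sphereFamilySurgeryRel, circleSurgeryRel, StdChart.coe_ballDiffeo, hfam, hcd, Diffeomorph.coe_refl, id_eq]

/-- **Discharge of fact 4 of the null tower** (every universe): if `N = ∂H` for a compact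
5-dimensional 2-handlebody `H` and `M` is a circle surgery of `N`, then `M = ∂H'` for the compact
5-dimensional 2-handlebody `H' = H ∪_N ω(N, ν)` (the argument of
`exists_isHandlebodyOfIndexLE_two_of_isCircleSurgery_holds0`, on the universe-polymorphic trace).
[cite: MilnorHCobordism1965, Lemma 3.7, Thms. 3.12–3.13] -/
theorem exists_isHandlebodyOfIndexLE_two_of_isCircleSurgery_holds :
    exists_isHandlebodyOfIndexLE_two_of_isCircleSurgery.{u} := by
  intro N M _ _ _ _ _ _ _ _ _ _ _ H _ _ _ _ _ _ hH φ hφ hφr c hs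
  obtain ⟨ν, hglue⟩ := hs
  let fam : FramedSphereFamily (𝓡 4) N Unit 1 3 :=
    { toFun := fun _ => ν.toFun
      isSmoothEmbedding := fun _ => ν.isSmoothEmbedding
      isOpen_range := fun _ => ν.isOpen_range
      disjoint_range := fun i j h => (h (Subsingleton.elim i j)).elim }
  obtain ⟨e⟩ := IsOpenGluing.nonempty_diffeomorph (ν.isOpenGluing_topEnd_univ fam fun _ => rfl) hglue
  -- the trace of the surgery, re-ended at `M`
  set X : Cobordism (3 + 1) N M := (traceCobordism fam StdChart.hkl).compDiffeomorphRight e.symm with hX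
  obtain ⟨g, hg, -, hg2⟩ := isElementary_traceCobordism fam StdChart.hkl
  have hgX : X.IsMorseFunction g := hg.compDiffeomorphRight e.symm
  have hgk : ∀ z, IsMCriticalPt (𝓡∂ (3 + 1 + 1)) g z → morseIndex (𝓡∂ (3 + 1 + 1)) g z ≤ 2 :=
    fun z hz => (hg2 z hz).le
  -- the boundary datum of `H` carried by `N`
  let b : BoundaryData (𝓡∂ (3 + 1 + 1)) H (𝓡 (3 + 1)) :=
    { carrier := N, incl := φ, isSmoothEmbedding := hφ, range_incl := hφr }
  haveI : Nonempty N := ⟨c ⟨EuclideanSpace.single 0 1, by simp⟩⟩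
  have hH' : IsHandlebodyOfIndexLE (3 + 1) 2 H := hH
  obtain ⟨V, _, _, _, _, _, _, A, hV⟩ :=
    exists_cobordismAttachment_isHandlebodyOfIndexLE (k := 2) b X (Diffeomorph.refl (𝓡 (3 + 1)) N ∞) hH' hgX hgk
  exact ⟨V, inferInstance, inferInstance, inferInstance, inferInstance, inferInstance, inferInstance, hV,
    A.jX ∘ X.inr, A.isSmoothEmbedding_jX_comp_inr, A.range_jX_comp_inr⟩

end Literature.Topology.FourManifolds
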